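import Summits.HodgeConjecture.HodgeConjecture.Theorems.Ring2AbelianAllAndreCorrespondenceCategory
import Summits.HodgeConjecture.HodgeConjecture.Theorems.NikulinTwinTransportTwinSimilitudeAlgebraicStubCorrTranspose
import Literature.AlgebraicGeometry.HodgeTheory.GysinProjectionNonvanishing
import Literature.AlgebraicGeometry.HodgeTheory.HodgeClassOfMorphismDuality
import Literature.AlgebraicGeometry.HodgeTheory.WeilClassesDescendingTransfer
import Literature.AlgebraicGeometry.HodgeTheory.ComplexOrientationCycleClassFacts
import Literature.AlgebraicGeometry.HodgeTheory.SupportedClassesRationalProofs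
import Literature.AlgebraicGeometry.HodgeTheory.HolomorphicBundleChernCharacterTopDegree
import HarnessLib

/-!
# Crux `LefschetzStandardB` (stmt-HodgeConjecture-17489), line `birth` — towards stub 3 `stub_charlesSpread`, III:
# the TRANSPOSE of a correspondence, its duality with the cup product, and its behaviour under conjugation

Route `HodgeConjecture/MotivatedLefschetzSplit`, crux #3 `LefschetzStandardB`; registered skeleton
`Cruxes/LefschetzStandardB/Lines/birth.lean`. Charles's spread `θ = [Γ]_* ∘ L^{l-b} ∘ s ∘ [Γ]^t` (2013, Prop. 8 ⇐)
uses the transpose `[Γ]^t` of the surjective family correspondence `[Γ]_* : H^{2l-b}(S) → Hᵇ(Z)` and two facts about it: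
`[Γ]^t` is injective (dual to the surjectivity of `[Γ]_*` under Poincaré duality), and "`⟨[Γ]_* u, w⟩_Z = ⟨u, [Γ]^t w⟩_S`".
On the tree's real carriers (complex orientation family, `corrAction`, `complexGysin`, Alexander–Whitney `cupProduct`),
for smooth projective `Z`, `S` of dimensions `d`, `l` and a class `δ ∈ H^{2e}((Z ⊗ S)(ℂ); ℂ)`:

* §1 the Gysin maps `pr_{Z*}`, `pr_{S*}` are INJECTIVE on the top degree `H^{2(d+l)}((Z ⊗ S)(ℂ); ℂ)` (a line; the class
  `pr_Z^* t_Z ∪ pr_S^* t_S` has non-zero image, projection formula and `complexGysin_fst_map_snd_ne_zero`);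
* §2 **duality without a trace**: `([δ]_* u) ∪ w = 0 ↔ u ∪ ([δ]^t w) = 0` (`cup_corrAction_eq_zero_iff`), where
  `[δ]_* u = pr_{Z*}(pr_S^* u ∪ δ)` and `[δ]^t w := pr_{S*}(pr_Z^* w ∪ δ)` — both sides are `±` a Gysin image of the same
  top-degree class `(pr_S^* u ∪ δ) ∪ pr_Z^* w` (projection formula, associativity and graded commutativity of `∪`);
* §3 `transpose_injective_of_surjective`: `[δ]_*` surjective ⟹ `[δ]^t` injective (§2 + the perfect cup pairing of `Z(ℂ)`,
  Hatcher Prop. 3.38);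
* §4 `[δ]^t` is the correspondence action of the braided class `σ_* δ` (`transposeAction_eq_corrAction`, from the tree's
  `complexGysin_fst_cupProduct_snd_braiding`), hence an algebraic correspondence when `δ` is algebraic;
* §5 **conjugation**: the Gysin maps of the complex orientation family commute with complex conjugation
  (`conjClass_complexGysin`: they preserve rational classes, which span), hence
  `conj([δ]^t w) = [conj δ]^t (conj w)` (`conjClass_transposeAction`).

Nothing here is a case of the Hodge conjecture or of `B(X)`; no definition, no named fact, no sorry.
References: [Charles2013] Prop. 8 (arXiv:1002.5011); [Fulton1998] §16.1 (transpose of a correspondence);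
[FultonYoungTableaux1997] App. B §B.1 (5)–(7); [HatcherAT2002] §3.2 Thm. 3.11, §3.3 Thm. 3.26, Prop. 3.38;
[VoisinHodgeI2002] Cor. 6.12, §7.3.2; [VoisinHodgeII2003] proof of Thm. 10.17 (10.7).
-/

noncomputable section

-- every declaration of this problem lives in `Summit.HodgeConjecture.HodgeConjecture.…` (summit = sub-problem)
set_option linter.dupNamespace false

open CategoryTheory AlgebraicGeometry MonoidalCategory CartesianMonoidalCategory
open Literature.AlgebraicGeometry.Motives Literature.AlgebraicGeometry.HodgeTheory
open Literature.AlgebraicTopology.SingularHomology (singularCohomology cupProduct cupProduct_assoc cupProduct_gradedComm_holds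
  cupProduct_one cupPairing cupPairing_apply)
open Summit.HodgeConjecture.HodgeConjecture.Ring2.AbelianAll
open Summit.HodgeConjecture.HodgeConjecture.Theorems.NikulinTwinTransport

namespace Summit.HodgeConjecture.HodgeConjecture.Theorems.LefschetzStandardB

variable {d l : ℕ} {Z S : SchemeOver ℂ}

/-! ## §1 The Gysin maps of the two projections are injective on the top degree of `Z ⊗ S` -/

/-- A non-zero top-degree class of a smooth projective `n`-fold exists (`H²ⁿ(X(ℂ); ℂ)` is a line).
[cite: HatcherAT2002, §3.3 Thm. 3.26] -/
theorem exists_top_ne_zero {n : ℕ} {X : SchemeOver ℂ} (hX : IsSmoothProjective n X) :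
    ∃ t : complexBetti X (2 * n), t ≠ 0 := by
  haveI : Nontrivial (complexBetti X (2 * n)) :=
    Module.nontrivial_of_finrank_eq_succ (finrank_complexBetti_two_mul_eq_one hX)
  exact exists_ne 0

/-- **`pr_{Z*} : H^{2(d+l)}((Z ⊗ S)(ℂ)) → H^{2d}(Z(ℂ))` is injective** (complex orientations): the source is a line and
`pr_{Z*}(pr_Z^* t_Z ∪ pr_S^* t_S) = t_Z ∪ pr_{Z*} pr_S^* t_S = c · t_Z ≠ 0`. [cite: FultonYoungTableaux1997, Appendix B §B.1 (5)–(7)]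
[cite: HatcherAT2002, §3.3 Thm. 3.26] -/
theorem complexGysin_fst_injective_top (hZ : IsSmoothProjective d Z) (hS : IsSmoothProjective l S)
    (h : 2 * (d + l) + 2 * d = 2 * d + 2 * (d + l)) :
    Function.Injective (complexGysin complexOrientationFamily (hZ.tensor_holds hS) hZ (fst Z S) h) := by
  have hμ := hasPoincareDuality_complexOrientationFamily
  have hZS := hZ.tensor_holds hS
  obtain ⟨tZ, htZ⟩ := exists_top_ne_zero hZ
  obtain ⟨tS, htS⟩ := exists_top_ne_zero hS
  -- `pr_{Z*} pr_S^* t_S = c • 1`, `c ≠ 0`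
  have hne := complexGysin_fst_map_snd_ne_zero complexOrientationFamily hZ hS htS
  obtain ⟨c, hc⟩ := exists_eq_smul_one complexOrientationFamily hZ
    (complexGysin complexOrientationFamily hZS hZ (fst Z S) (show 2 * l + 2 * d = 0 + 2 * (d + l) by omega)
      (complexBetti.map (snd Z S) (2 * l) tS))
  have hc0 : c ≠ 0 := by rintro rfl; exact hne (by rw [hc, zero_smul])
  -- the image of `G = pr_Z^* t_Z ∪ pr_S^* t_S` is `c • t_Z ≠ 0`
  set G := cupProduct (show 2 * d + 2 * l = 2 * (d + l) by omega) (complexBetti.map (fst Z S) (2 * d) tZ)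
    (complexBetti.map (snd Z S) (2 * l) tS) with hG
  have hGim : complexGysin complexOrientationFamily hZS hZ (fst Z S) h G = c • tZ := by
    rw [hG, complexGysin_cup hμ hZS hZ (fst Z S) _ h (show 2 * l + 2 * d = 0 + 2 * (d + l) by omega)
      (Nat.add_zero _), hc, map_smul, cupProduct_one]
  have hGne : complexGysin complexOrientationFamily hZS hZ (fst Z S) h G ≠ 0 := by
    rw [hGim]; exact smul_ne_zero hc0 htZ
  intro x y hxy
  rw [← sub_eq_zero] at hxy ⊢
  rw [← map_sub] at hxy
  by_contra hne'
  obtain ⟨t, ht⟩ := exists_eq_smul_of_top complexOrientationFamily hZS hne' G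
  apply hGne
  rw [ht, map_smul, hxy, smul_zero]

/-- **`pr_{S*} : H^{2(d+l)}((Z ⊗ S)(ℂ)) → H^{2l}(S(ℂ))` is injective** (mirror of the previous lemma).
[cite: FultonYoungTableaux1997, Appendix B §B.1 (5)–(7)] [cite: HatcherAT2002, §3.3 Thm. 3.26] -/
theorem complexGysin_snd_injective_top (hZ : IsSmoothProjective d Z) (hS : IsSmoothProjective l S)
    (h : 2 * (d + l) + 2 * l = 2 * l + 2 * (d + l)) :
    Function.Injective (complexGysin complexOrientationFamily (hZ.tensor_holds hS) hS (snd Z S) h) := by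
  have hμ := hasPoincareDuality_complexOrientationFamily
  have hZS := hZ.tensor_holds hS
  obtain ⟨tZ, htZ⟩ := exists_top_ne_zero hZ
  obtain ⟨tS, htS⟩ := exists_top_ne_zero hS
  have hne := complexGysin_snd_map_fst_ne_zero complexOrientationFamily hZ hS htZ
  obtain ⟨c, hc⟩ := exists_eq_smul_one complexOrientationFamily hS
    (complexGysin complexOrientationFamily hZS hS (snd Z S) (show 2 * d + 2 * l = 0 + 2 * (d + l) by omega)
      (complexBetti.map (fst Z S) (2 * d) tZ))
  have hc0 : c ≠ 0 := by rintro rfl; exact hne (by rw [hc, zero_smul])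
  set G := cupProduct (show 2 * l + 2 * d = 2 * (d + l) by omega) (complexBetti.map (snd Z S) (2 * l) tS)
    (complexBetti.map (fst Z S) (2 * d) tZ) with hG
  have hGim : complexGysin complexOrientationFamily hZS hS (snd Z S) h G = c • tS := by
    rw [hG, complexGysin_cup hμ hZS hS (snd Z S) _ h (show 2 * d + 2 * l = 0 + 2 * (d + l) by omega)
      (Nat.add_zero _), hc, map_smul, cupProduct_one]
  have hGne : complexGysin complexOrientationFamily hZS hS (snd Z S) h G ≠ 0 := by
    rw [hGim]; exact smul_ne_zero hc0 htS
  intro x y hxy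
  rw [← sub_eq_zero] at hxy ⊢
  rw [← map_sub] at hxy
  by_contra hne'
  obtain ⟨t, ht⟩ := exists_eq_smul_of_top complexOrientationFamily hZS hne' G
  apply hGne
  rw [ht, map_smul, hxy, smul_zero]

/-! ## §2 Duality of a correspondence and its transpose under the cup product -/

/-- **`([δ]_* u) ∪ w = 0 ↔ u ∪ ([δ]^t w) = 0`.** For `δ ∈ H^{2e}((Z ⊗ S)(ℂ))`, `u ∈ Hᵃ'(S(ℂ))`, `w ∈ Hᵃ(Z(ℂ))` with
`a' + 2e = b + 2l`, `b + a = 2d`, `a + 2e = b_S + 2d`, `a' + b_S = 2l`: the cup product on `Z` of `[δ]_* u = pr_{Z*}(pr_S^* u ∪ δ)`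
with `w` vanishes iff the cup product on `S` of `u` with the TRANSPOSE `[δ]^t w = pr_{S*}(pr_Z^* w ∪ δ)` does — both are, up to
a sign, the images under the injective `pr_{Z*}`, resp. `pr_{S*}`, of the top class `(pr_S^* u ∪ δ) ∪ pr_Z^* w` of `Z ⊗ S`
(projection formula `f_*(f^* x ∪ y) = x ∪ f_* y`, associativity and graded commutativity). This is the carrier form of
"`⟨[Γ]_* u, w⟩_Z = ⟨u, [Γ]^t w⟩_S`". [cite: Fulton1998, §16.1] [cite: FultonYoungTableaux1997, Appendix B §B.1 (6)]
[cite: HatcherAT2002, §3.2 Thm. 3.11] -/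
theorem cup_corrAction_eq_zero_iff (hZ : IsSmoothProjective d Z) (hS : IsSmoothProjective l S) {e a' b a bS : ℕ}
    (h₁ : a' + 2 * e = b + 2 * l) (hba : b + a = 2 * d) (h₂ : a + 2 * e + 2 * l = bS + 2 * (d + l))
    (hS' : a' + bS = 2 * l) (δ : complexBetti (Z ⊗ S) (2 * e)) (u : complexBetti S a') (w : complexBetti Z a) :
    cupProduct hba (corrAction complexOrientationFamily hZ hS h₁ δ u) w = 0 ↔
      cupProduct hS' u (complexGysin complexOrientationFamily (hZ.tensor_holds hS) hS (snd Z S) h₂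
        (cupProduct rfl (complexBetti.map (fst Z S) a w) δ)) = 0 := by
  have hμ := hasPoincareDuality_complexOrientationFamily
  have hZS := hZ.tensor_holds hS
  -- the common top class `Ω = (pr_S^* u ∪ δ) ∪ pr_Z^* w`
  have hΩdeg : (a' + 2 * e) + a = 2 * (d + l) := by omega
  set Ω := cupProduct hΩdeg (cupProduct rfl (complexBetti.map (snd Z S) a' u) δ) (complexBetti.map (fst Z S) a w)
    with hΩ
  have hfst : 2 * (d + l) + 2 * d = 2 * d + 2 * (d + l) := by omega
  have hsnd : 2 * (d + l) + 2 * l = 2 * l + 2 * (d + l) := by omega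
  -- LHS `= (-1)^{ba} (-1)^{a(a'+2e)} pr_{Z*} Ω`
  have hL : cupProduct hba (corrAction complexOrientationFamily hZ hS h₁ δ u) w =
      ((-1 : ℂ) ^ (b * a) * (-1 : ℂ) ^ (a * (a' + 2 * e))) •
        complexGysin complexOrientationFamily hZS hZ (fst Z S) hfst Ω := by
    rw [corrAction_apply, cupProduct_gradedComm_holds ℂ _ hba (by omega : a + b = 2 * d),
      ← complexGysin_cup hμ hZS hZ (fst Z S) (by omega : a + (a' + 2 * e) = 2 * (d + l)) hfst
        (corrAction_degree d h₁) (by omega : a + b = 2 * d),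
      cupProduct_gradedComm_holds ℂ _ (by omega : a + (a' + 2 * e) = 2 * (d + l)) hΩdeg, map_smul, smul_smul]
  -- RHS `= (-1)^{a' a} (-1)^{a(a'+2e)} pr_{S*} Ω` (the total sign is `+1`, but we do not need that)
  have hR : cupProduct hS' u (complexGysin complexOrientationFamily hZS hS (snd Z S) h₂
        (cupProduct rfl (complexBetti.map (fst Z S) a w) δ)) =
      ((-1 : ℂ) ^ (a' * a) * (-1 : ℂ) ^ (a * (a' + 2 * e))) •
        complexGysin complexOrientationFamily hZS hS (snd Z S) hsnd Ω := by
    rw [← complexGysin_cup hμ hZS hS (snd Z S) (by omega : a' + (a + 2 * e) = 2 * (d + l)) hsnd h₂ hS',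
      ← cupProduct_assoc (rfl : a' + a = a' + a) rfl (by omega : a' + a + 2 * e = 2 * (d + l))
        (by omega : a' + (a + 2 * e) = 2 * (d + l)),
      cupProduct_gradedComm_holds ℂ _ (rfl : a' + a = a' + a) (by omega : a + a' = a' + a), map_smul,
      LinearMap.smul_apply,
      cupProduct_assoc (by omega : a + a' = a' + a) rfl (by omega : a' + a + 2 * e = 2 * (d + l)) (by omega),
      cupProduct_gradedComm_holds ℂ _ (by omega : a + (a' + 2 * e) = 2 * (d + l)) hΩdeg, map_smul, map_smul, smul_smul,
      ← hΩ]
  have hu : ∀ k : ℕ, ((-1 : ℂ) ^ k) ≠ 0 := fun k ↦ pow_ne_zero _ (neg_ne_zero.2 one_ne_zero)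
  rw [hL, hR, smul_eq_zero, smul_eq_zero, or_iff_right (mul_ne_zero (hu _) (hu _)),
    or_iff_right (mul_ne_zero (hu _) (hu _))]
  constructor
  · intro h0
    have hΩ0 : Ω = 0 := complexGysin_fst_injective_top hZ hS hfst (by rw [h0, map_zero])
    rw [hΩ0, map_zero]
  · intro h0
    have hΩ0 : Ω = 0 := complexGysin_snd_injective_top hZ hS hsnd (by rw [h0, map_zero])
    rw [hΩ0, map_zero]

/-! ## §3 `[δ]_*` surjective ⟹ `[δ]^t` injective -/

/-- **If `[δ]_* : Hᵃ'(S(ℂ)) → Hᵇ(Z(ℂ))` is surjective then its transpose `[δ]^t : Hᵃ(Z(ℂ)) → H^{b_S}(S(ℂ))` is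
injective** (`b + a = 2d`): if `[δ]^t w = 0` then `([δ]_* u) ∪ w = 0` for all `u` (§2), so `v ∪ w = 0` for every `v ∈ Hᵇ(Z)`,
and `w = 0` by the perfect cup pairing of the closed oriented manifold `Z(ℂ)` (Hatcher Prop. 3.38).
[cite: HatcherAT2002, §3.3 Prop. 3.38] [cite: Fulton1998, §16.1] [cite: Charles2013, proof of Prop. 8 (arXiv:1002.5011)] -/
theorem transpose_injective_of_surjective (hZ : IsSmoothProjective d Z) (hS : IsSmoothProjective l S) {e a' b a bS : ℕ}
    (h₁ : a' + 2 * e = b + 2 * l) (hba : b + a = 2 * d) (h₂ : a + 2 * e + 2 * l = bS + 2 * (d + l))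
    (hS' : a' + bS = 2 * l) (δ : complexBetti (Z ⊗ S) (2 * e))
    (hsurj : Function.Surjective (corrAction complexOrientationFamily hZ hS h₁ δ)) {w : complexBetti Z a}
    (hw : complexGysin complexOrientationFamily (hZ.tensor_holds hS) hS (snd Z S) h₂
      (cupProduct rfl (complexBetti.map (fst Z S) a w) δ) = 0) :
    w = 0 := by
  have hperf := isPerfPair_cupPairing_complexPoints complexOrientationFamily hZ hba
  apply hperf.bijective_right.injective
  rw [map_zero]
  refine LinearMap.ext fun v ↦ ?_
  obtain ⟨u, rfl⟩ := hsurj v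
  rw [LinearMap.flip_apply, LinearMap.zero_apply, cupPairing_apply]
  have h0 := (cup_corrAction_eq_zero_iff hZ hS h₁ hba h₂ hS' δ u w).2 (by rw [hw, map_zero])
  change (Literature.AlgebraicTopology.SingularHomology.kroneckerPairing ℂ ℂ (ComplexPoints Z) (2 * d))
      (cupProduct hba (corrAction complexOrientationFamily hZ hS h₁ δ u) w) _ = 0
  rw [h0, map_zero, LinearMap.zero_apply]

/-! ## §4 The transpose is the correspondence action of the braided class -/

/-- **`[δ]^t = [σ_* δ]_*`**: the transpose action `w ↦ pr_{S*}(pr_Z^* w ∪ δ)` through the SECOND projection of `Z ⊗ S` is the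
correspondence action (`corrAction`, first factor of `S ⊗ Z` receiving) of the braided class `σ_* δ`, `σ = β_ Z S`
(`complexGysin_fst_cupProduct_snd_braiding`). [cite: Fulton1998, §16.1] [cite: FultonYoungTableaux1997, Appendix B §B.1 (5)–(6)] -/
theorem transposeAction_eq_corrAction (hZ : IsSmoothProjective d Z) (hS : IsSmoothProjective l S) {e a bS : ℕ}
    (h₂ : a + 2 * e + 2 * l = bS + 2 * (d + l)) (h₂' : a + 2 * e = bS + 2 * d) (δ : complexBetti (Z ⊗ S) (2 * e))
    (w : complexBetti Z a) :
    complexGysin complexOrientationFamily (hZ.tensor_holds hS) hS (snd Z S) h₂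
        (cupProduct rfl (complexBetti.map (fst Z S) a w) δ) =
      corrAction complexOrientationFamily hS hZ h₂'
        (complexGysin complexOrientationFamily (hZ.tensor_holds hS) (hS.tensor_holds hZ) (β_ Z S).hom
          (by omega : 2 * e + 2 * (l + d) = 2 * e + 2 * (d + l)) δ) w := by
  rw [corrAction_apply]
  exact (complexGysin_fst_cupProduct_snd_braiding complexOrientationFamily hasPoincareDuality_complexOrientationFamily hS
    (hZ.tensor_holds hS) (hS.tensor_holds hZ) rfl _ (corrAction_degree l h₂') h₂ δ w).symm

/-- **The transpose of an algebraic correspondence is an algebraic correspondence**: as a linear map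
`pr_{S*} ∘ (· ∪ δ) ∘ pr_Z^* : Hᵃ(Z(ℂ)) → H^{b_S}(S(ℂ))`, `b_S ≤ 2l`, for `δ ∈ Nᵉ H^{2e}((Z ⊗ S)(ℂ))` (the braided class
`σ_* δ` is algebraic, `complexGysin_braiding_hom_mem_algebraicClasses`). [cite: Fulton1998, §16.1] [cite: Andre1996Motifs, §2.1 (p. 14)] -/
theorem isAlgebraicCorrespondence_transposeAction (hZ : IsSmoothProjective d Z) (hS : IsSmoothProjective l S)
    {e a bS : ℕ} (h₂ : a + 2 * e + 2 * l = bS + 2 * (d + l)) (hbS : bS ≤ 2 * l) {δ : complexBetti (Z ⊗ S) (2 * e)}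
    (hδ : δ ∈ algebraicClasses (Z ⊗ S) e) :
    IsAlgebraicCorrespondence l d S Z
      (complexGysin complexOrientationFamily (hZ.tensor_holds hS) hS (snd Z S) h₂ ∘ₗ
        (cupProduct (rfl : a + 2 * e = a + 2 * e)).flip δ ∘ₗ (complexBetti.map (fst Z S) a).hom) := by
  have h₂' : a + 2 * e = bS + 2 * d := by omega
  have heq : complexGysin complexOrientationFamily (hZ.tensor_holds hS) hS (snd Z S) h₂ ∘ₗ
        (cupProduct (rfl : a + 2 * e = a + 2 * e)).flip δ ∘ₗ (complexBetti.map (fst Z S) a).hom =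
      corrAction complexOrientationFamily hS hZ h₂'
        (complexGysin complexOrientationFamily (hZ.tensor_holds hS) (hS.tensor_holds hZ) (β_ Z S).hom
          (by omega : 2 * e + 2 * (l + d) = 2 * e + 2 * (d + l)) δ) := by
    refine LinearMap.ext fun w ↦ ?_
    simp only [LinearMap.comp_apply, LinearMap.flip_apply]
    exact transposeAction_eq_corrAction hZ hS h₂ h₂' δ w
  rw [heq]
  exact isAlgebraicCorrespondence_corrAction_complex hS hZ h₂' hbS
    (complexGysin_braiding_hom_mem_algebraicClasses complexOrientationFamily hasPoincareDuality_complexOrientationFamily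
      (hZ.tensor_holds hS) (hS.tensor_holds hZ) _ hδ)

/-! ## §5 Conjugation -/

/-- **The Gysin morphisms of the complex orientation family commute with complex conjugation**: `conj (f_* w) = f_* (conj w)`
for `f : Y ⟶ X` of smooth projective varieties (`f_*` maps rational classes to rational classes —
`isRationalClass_complexGysin_complexOrientationFamily` — rational classes are real, and they span `H•(Y(ℂ); ℂ)`).
[cite: VoisinHodgeI2002, Cor. 6.12 and §7.3.2] -/
theorem conjClass_complexGysin {m n : ℕ} {Y X : SchemeOver ℂ} (hY : IsSmoothProjective m Y) (hX : IsSmoothProjective n X)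
    (f : Y ⟶ X) {a b : ℕ} (hab : a + 2 * n = b + 2 * m) (w : complexBetti Y a) :
    conjClass (ComplexPoints X) b (complexGysin complexOrientationFamily hY hX f hab w) =
      complexGysin complexOrientationFamily hY hX f hab (conjClass (ComplexPoints Y) a w) := by
  have hw : w ∈ Submodule.span ℂ {c : complexBetti Y a | IsRationalClass c} := by
    rw [span_isRationalClass_eq_top_of_isSmoothProjective_holds m Y hY a]; trivial
  induction hw using Submodule.span_induction with
  | mem c hc =>
    rw [hc.conjClass_eq, (isRationalClass_complexGysin_complexOrientationFamily hY hX f hab hc).conjClass_eq]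
  | zero => rw [conjClass_zero, map_zero, conjClass_zero]
  | add x y _ _ hx hy => rw [map_add, conjClass_add, hx, hy, conjClass_add, map_add]
  | smul t x _ hx => rw [map_smul, conjClass_smul, hx, conjClass_smul, map_smul]

/-- `conj (g^* c) = g^* (conj c)` for the pull-back along a morphism of `ℂ`-schemes (`conjClass_map` for `g(ℂ)`).
[cite: VoisinHodgeI2002, Cor. 6.12] -/
theorem conjClass_complexBetti_map {X Y : SchemeOver ℂ} (g : X ⟶ Y) (k : ℕ) (c : complexBetti Y k) :
    conjClass (ComplexPoints X) k (complexBetti.map g k c) = complexBetti.map g k (conjClass (ComplexPoints Y) k c) :=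
  conjClass_map _ c

/-- **`conj ([δ]^t w) = [conj δ]^t (conj w)`**: the transpose action commutes with conjugation up to conjugating the class
(conjugation is multiplicative, natural, and commutes with `pr_{S*}`). [cite: VoisinHodgeI2002, Cor. 6.12 and §7.3.2] -/
theorem conjClass_transposeAction (hZ : IsSmoothProjective d Z) (hS : IsSmoothProjective l S) {e a bS : ℕ}
    (h₂ : a + 2 * e + 2 * l = bS + 2 * (d + l)) (δ : complexBetti (Z ⊗ S) (2 * e)) (w : complexBetti Z a) :
    conjClass (ComplexPoints S) bS (complexGysin complexOrientationFamily (hZ.tensor_holds hS) hS (snd Z S) h₂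
        (cupProduct rfl (complexBetti.map (fst Z S) a w) δ)) =
      complexGysin complexOrientationFamily (hZ.tensor_holds hS) hS (snd Z S) h₂
        (cupProduct rfl (complexBetti.map (fst Z S) a (conjClass (ComplexPoints Z) a w))
          (conjClass (ComplexPoints (Z ⊗ S)) (2 * e) δ)) := by
  rw [conjClass_complexGysin, conjClass_cupProduct, conjClass_complexBetti_map]

/-- The same for the correspondence action itself: `conj ([δ]_* u) = [conj δ]_* (conj u)`.
[cite: VoisinHodgeI2002, Cor. 6.12 and §7.3.2] -/
theorem conjClass_corrAction (hZ : IsSmoothProjective d Z) (hS : IsSmoothProjective l S) {e a' b : ℕ}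
    (h₁ : a' + 2 * e = b + 2 * l) (δ : complexBetti (Z ⊗ S) (2 * e)) (u : complexBetti S a') :
    conjClass (ComplexPoints Z) b (corrAction complexOrientationFamily hZ hS h₁ δ u) =
      corrAction complexOrientationFamily hZ hS h₁ (conjClass (ComplexPoints (Z ⊗ S)) (2 * e) δ)
        (conjClass (ComplexPoints S) a' u) := by
  rw [corrAction_apply, corrAction_apply, conjClass_complexGysin, conjClass_cupProduct, conjClass_complexBetti_map]

end Summit.HodgeConjecture.HodgeConjecture.Theorems.LefschetzStandardB

end
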